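import Summits.BirchSwinnertonDyer.Rank1Residual.X11b.BDPRouteLocalTorsionPurity
import Summits.BirchSwinnertonDyer.Rank1Residual.X11b.BDPRouteNonsingularPartIndex
import HarnessLib

/-!
# Class X11b, route p2: Greenberg's Lemma 3.3 EXACT — the arithmetic transport: the `D_v`-fixed
# `p`-power torsion of `E(K̄)` is `X(K_v)[p^∞]`, `nonsingularPart` matching `X₀(K_v)`
# (cell `b2b-bsdres`, sub-cell `multr1-p2`, gen 20)

HONEST FRAMING (verbatim, cell `b2b-bsdres`): the goal of the cell is to DELETE the
COMBINATION-SHAPED residual classes for ALL analytic-rank `≤ 1` curves over `ℚ` — "full BSD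
formula for every rank `≤ 1` curve in class `C`" assembled STRICTLY from published theorems — so
that the rank-`≤ 1` remainder becomes exactly the CONSTRUCTION-SHAPED classes, which are TYPED
(missing-input Props), NOT attempted; this is not "finishing BSD". Research route `p2` for class
X11b; no claim beyond the stated class; nothing booked; X11b stays CONSTRUCTION-SHAPED. Theorems
only; no definition, no named fact, no `sorry`.

## Content

Notation of gen 14: `K` a number field, `E/K` elliptic (`W`), `v ∤ p` a finite place, `D_v = decomp v`,
`M₀ = nonsingularPart ≤ E(K̄)^{I_v}` (Silverman's `E₀(K_v^{nr})^{alg}`, data `hw`, `hW₀`, `Φ`, `hΦ`).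

* **`natCard_decompFixed_primary_eq_mul`** — the set `S` of `D_v`-fixed `p`-power torsion points of
  `E(K̄)` (finite, `finite_setOf_smul_decomp_eq_of_isPrimary`; it is `ker(γ_v − 1)` on `B_v`) satisfies
  `#S = #{m ∈ S : m ∈ M₀} · p ^ ord_p c_v(E/K)`. Proof: `F = Φ ∘ ι_*` maps `S` bijectively onto
  `X(K_v)[p^∞]` on the minimal model (Galois descent `exists_point_map_eq_of_forall_map_eq`; onto since
  torsion of `E(K̄_v)` comes from `E(K̄)`, `exists_pointsMapOfEmb_eq_of_nsmul_eq_zero`), with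
  `m ∈ M₀ ↔ F m ∈ X₀(K_v)` (`hasNonsingularReduction_algebraMap_iff`), and then the local purity count
  `#X(K_v)[p^∞] = #X₀(K_v)[p^∞] · c_v^{(p)}` (`BDPRouteLocalTorsionPurity`).

Consumed by `BDPRouteLocalKernelExact.lean` (the coinvariant identity and atom (P11) modulo the
inflation–restriction transport). CONDITIONAL use only; nothing booked; reach and labels unchanged.

References: [GreenbergLNM1716] §3 Lemma 3.3 (p. 87), §4 proof of Thm. 4.1 (p. 74: "`ker r_v` has
order `c_v^{(p)}`"); [SilvermanAEC2009] VII.2.1, VII.3.1, Thm. VII.6.1 / Cor. VII.6.2, VIII.§1.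
-/

noncomputable section

open scoped Classical NNReal

open NumberField IsDedekindDomain Field IsDedekindDomain.HeightOneSpectrum WeierstrassCurve
open Literature.NumberTheory.EllipticCurves Literature.NumberTheory.EllipticCurves.GreenbergSelmer
open Literature.NumberTheory.GaloisRepresentations

universe u

namespace Summit.BirchSwinnertonDyer.Rank1Residual.X11b.AcSelmer

/-! ## The arithmetic: `D_v`-fixed `p`-power torsion of `E(K̄)` vs `X(K_v)[p^∞]` and `X₀(K_v)[p^∞]` -/

section Arithmetic

variable {K : Type u} [Field K] [NumberField K] {W : WeierstrassCurve K} {v : HeightOneSpectrum (𝓞 K)}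
  {w : Valuation (AlgebraicClosure (v.adicCompletion K)) ℝ≥0}
  (hw : ∀ x, (w x : ℝ) =
    spectralNorm (v.adicCompletion K) (AlgebraicClosure (v.adicCompletion K)) x)
  {W₀ : WeierstrassCurve w.integer}
  (hW₀ : ((W.localMinimalIntegralModel v).map (algebraMap (v.adicCompletionIntegers K)
      (v.adicCompletion K))).baseChange (AlgebraicClosure (v.adicCompletion K)) =
    W₀.baseChange (AlgebraicClosure (v.adicCompletion K)))
  {Φ : localPoints W (v.adicCompletion K) ≃+
    (((W.localMinimalIntegralModel v).map (algebraMap (v.adicCompletionIntegers K)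
      (v.adicCompletion K))).baseChange (AlgebraicClosure (v.adicCompletion K))).toAffine.Point}
  (hΦ : ∀ (σ : absoluteGaloisGroup (v.adicCompletion K)) (Q : localPoints W (v.adicCompletion K)),
    Φ (σ • Q) = Affine.Point.map ((absoluteGaloisGroup.toAlgEquiv _ σ :
        AlgebraicClosure (v.adicCompletion K) ≃ₐ[v.adicCompletion K]
          AlgebraicClosure (v.adicCompletion K)) :
        AlgebraicClosure (v.adicCompletion K) →ₐ[v.adicCompletion K]
          AlgebraicClosure (v.adicCompletion K)) (Φ Q))

include hw hΦ in
/-- **The `D_v`-fixed `p`-power torsion of `E(K̄)` is `X(K_v)[p^∞]`, with `M₀` matching `X₀(K_v)`;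
hence it numbers `#(M₀ ∩ ·) · p ^ ord_p c_v`.** For `v ∤ p`: the set `S` of points of `E(K̄)` fixed by
`D_v` and killed by a power of `p` is finite (`finite_setOf_smul_decomp_eq_of_isPrimary`), and
`#S = #{m ∈ S : m ∈ M₀} · p ^ ord_p c_v(E/K)`. Proof: `F = Φ ∘ ι_*` maps `S` bijectively onto the
`p`-power torsion of `X(K_v)` on the minimal model (`D_v`-fixed ⟹ `Γ_{K_v}`-fixed ⟹ `K_v`-rational,
`exists_point_map_eq_of_forall_map_eq`; onto because torsion of `E(K̄_v)` comes from `E(K̄)`,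
`exists_pointsMapOfEmb_eq_of_nsmul_eq_zero`), with `m ∈ M₀ ↔ F m ∈ X₀(K_v)`
(`hasNonsingularReduction_algebraMap_iff`); then the purity count
`natCard_primaryComponent_point_eq_mul_pow_localTamagawaNumber`. [cite: GreenbergLNM1716, §4 proof of Thm. 4.1 (p. 74)]
[cite: SilvermanAEC2009, Thm. VII.6.1 / Cor. VII.6.2, VII.3.1, VIII.§1] -/
theorem natCard_decompFixed_primary_eq_mul [W.IsElliptic] {p : ℕ} [Fact p.Prime]
    (hpv : (p : 𝓞 K) ∉ v.asIdeal) :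
    Nat.card {m : W.geomPoints // (∀ x ∈ decomp v, x • m = m) ∧ ∃ k : ℕ, p ^ k • m = 0} =
      Nat.card {m : W.geomPoints // ((∀ x ∈ decomp v, x • m = m) ∧ ∃ k : ℕ, p ^ k • m = 0) ∧
          m ∈ (nonsingularPart W hW₀ Φ).map (FixedPoints.addSubgroup
            ↥((adicCompletionPrime K v).inertia (absoluteGaloisGroup K)) W.geomPoints).subtype} *
        p ^ padicValNat p
          ((W.baseChange (v.adicCompletion K)).localTamagawaNumber (v.adicCompletionIntegers K)) := by
  have hpp : (p : ℕ).Prime := Fact.out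
  haveI : ((W.localMinimalIntegralModel v).map (algebraMap (v.adicCompletionIntegers K)
      (v.adicCompletion K))).IsElliptic := W.isElliptic_map_localMinimalIntegralModel (v := v)
  have hX := LocalPurity.baseChange_self_eq W v
  obtain ⟨𝔐, h𝔐⟩ := v.localPrimesAbove_nonempty
  -- the two sets
  set S : Set W.geomPoints := {m | (∀ x ∈ decomp v, x • m = m) ∧ ∃ k : ℕ, p ^ k • m = 0} with hSdef
  set S₀ : Set W.geomPoints := {m | ((∀ x ∈ decomp v, x • m = m) ∧ ∃ k : ℕ, p ^ k • m = 0) ∧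
    m ∈ (nonsingularPart W hW₀ Φ).map (FixedPoints.addSubgroup
      ↥((adicCompletionPrime K v).inertia (absoluteGaloisGroup K)) W.geomPoints).subtype} with hS₀def
  change Nat.card S = Nat.card S₀ * _
  -- `F = Φ ∘ ι_*` is injective and additive
  have hFinj : ∀ a b : W.geomPoints,
      Φ (pointsMapOfEmb W (closureEmb (K := K) (v.adicCompletion K)) a) =
        Φ (pointsMapOfEmb W (closureEmb (K := K) (v.adicCompletion K)) b) → a = b :=
    fun a b hab ↦ pointsMapOfEmb_injective W _ (Φ.injective hab)
  -- the inertia group lies in `D_v`; points of `S` are inertia-fixed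
  have hIdec : (adicCompletionPrime K v).inertia (absoluteGaloisGroup K) ≤ decomp v := by
    intro i hi
    rw [decomp_eq_decompositionSubgroup_adicCompletionPrime]
    exact Ideal.inertia_le_decompositionSubgroup _ _ hi
  have hmemFix : ∀ m ∈ S, m ∈ FixedPoints.addSubgroup
      ↥((adicCompletionPrime K v).inertia (absoluteGaloisGroup K)) W.geomPoints :=
    fun m hm x ↦ hm.1 _ (hIdec x.2)
  -- `F m` is `Γ_{K_v}`-fixed for `m ∈ S`
  have hFfix : ∀ m ∈ S, ∀ σ : absoluteGaloisGroup (v.adicCompletion K),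
      Affine.Point.map ((absoluteGaloisGroup.toAlgEquiv _ σ :
          AlgebraicClosure (v.adicCompletion K) ≃ₐ[v.adicCompletion K]
            AlgebraicClosure (v.adicCompletion K)) :
          AlgebraicClosure (v.adicCompletion K) →ₐ[v.adicCompletion K]
            AlgebraicClosure (v.adicCompletion K))
        (Φ (pointsMapOfEmb W (closureEmb (K := K) (v.adicCompletion K)) m)) =
        Φ (pointsMapOfEmb W (closureEmb (K := K) (v.adicCompletion K)) m) := by
    intro m hm σ
    rw [← transport_pointsMapOfEmb_smul hΦ]
    congr 2
    exact hm.1 _ (resGalOfEmb_closureEmb_mem_decomp v σ)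
  -- Galois descent: `F m = (d m)_{K̄_v}` with `d m ∈ X(K_v)`
  have hdesc : ∀ m : S, ∃ R : (((W.localMinimalIntegralModel v).map (algebraMap
      (v.adicCompletionIntegers K) (v.adicCompletion K))).baseChange (v.adicCompletion K)).toAffine.Point,
      Affine.Point.map (W' := (W.localMinimalIntegralModel v).map (algebraMap
          (v.adicCompletionIntegers K) (v.adicCompletion K)))
        (Algebra.ofId (v.adicCompletion K) (AlgebraicClosure (v.adicCompletion K))) R =
        Φ (pointsMapOfEmb W (closureEmb (K := K) (v.adicCompletion K)) m) :=
    fun m ↦ exists_point_map_eq_of_forall_map_eq _ (hFfix m m.2)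
  choose d₀ hd₀ using hdesc
  have hinj := Affine.Point.map_injective (W' := (W.localMinimalIntegralModel v).map (algebraMap
      (v.adicCompletionIntegers K) (v.adicCompletion K)))
    (Algebra.ofId (v.adicCompletion K) (AlgebraicClosure (v.adicCompletion K)))
  -- `d m` is `p`-power torsion
  have hd₀tors : ∀ m : S, ∃ k : ℕ, p ^ k • Affine.Point.congrEquiv hX (d₀ m) = 0 := by
    intro m
    obtain ⟨k, hk⟩ := m.2.2
    refine ⟨k, ?_⟩
    rw [← map_nsmul]
    have h0 : p ^ k • d₀ m = 0 := hinj (by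
      rw [map_nsmul, hd₀, map_zero, ← map_nsmul, ← map_nsmul, hk, map_zero, map_zero])
    rw [h0, map_zero]
  -- the map `f : S → X(K_v)[p^∞]`
  let f : S → AddCommGroup.primaryComponent
      ((W.localMinimalIntegralModel v).baseChange (v.adicCompletion K)).toAffine.Point p :=
    fun m ↦ ⟨Affine.Point.congrEquiv hX (d₀ m), (AddCommGroup.mem_primaryComponent).mpr (hd₀tors m)⟩
  have hf : ∀ m : S, ((f m : AddCommGroup.primaryComponent
      ((W.localMinimalIntegralModel v).baseChange (v.adicCompletion K)).toAffine.Point p) :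
        ((W.localMinimalIntegralModel v).baseChange (v.adicCompletion K)).toAffine.Point) =
      Affine.Point.congrEquiv hX (d₀ m) := fun _ ↦ rfl
  -- `f` is injective
  have hfinj : Function.Injective f := by
    intro a b hab
    have h0 : Affine.Point.congrEquiv hX (d₀ a) = Affine.Point.congrEquiv hX (d₀ b) := by
      rw [← hf, ← hf, hab]
    have h1 : d₀ a = d₀ b := (Affine.Point.congrEquiv hX).injective h0
    have h2 := hd₀ a
    rw [h1, hd₀ b] at h2
    exact Subtype.ext (hFinj _ _ h2.symm)
  -- `f` is surjective: torsion of `X(K̄_v)` comes from `E(K̄)`, and is `D_v`-fixed when `K_v`-rational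
  have hfsurj : Function.Surjective f := by
    rintro ⟨R₀, hR₀⟩
    obtain ⟨k, hk⟩ := (AddCommGroup.mem_primaryComponent).mp hR₀
    have hQk : p ^ k • Φ.symm (Affine.Point.map (W' := (W.localMinimalIntegralModel v).map (algebraMap
        (v.adicCompletionIntegers K) (v.adicCompletion K)))
        (Algebra.ofId (v.adicCompletion K) (AlgebraicClosure (v.adicCompletion K)))
        (Affine.Point.congrEquiv hX.symm R₀)) = 0 := by
      apply Φ.injective
      rw [map_nsmul, AddEquiv.apply_symm_apply, map_zero, ← map_nsmul, ← map_nsmul, hk, map_zero,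
        map_zero]
    obtain ⟨m, hmk, hm⟩ := exists_pointsMapOfEmb_eq_of_nsmul_eq_zero W
      (closureEmb (K := K) (v.adicCompletion K)) (pow_ne_zero k hpp.ne_zero) hQk
    have hFm : Φ (pointsMapOfEmb W (closureEmb (K := K) (v.adicCompletion K)) m) =
        Affine.Point.map (W' := (W.localMinimalIntegralModel v).map (algebraMap
          (v.adicCompletionIntegers K) (v.adicCompletion K)))
          (Algebra.ofId (v.adicCompletion K) (AlgebraicClosure (v.adicCompletion K)))
          (Affine.Point.congrEquiv hX.symm R₀) := by
      rw [hm, AddEquiv.apply_symm_apply]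
    have hmS : m ∈ S := by
      refine ⟨fun x hx ↦ ?_, k, hmk⟩
      obtain ⟨σ, rfl⟩ := exists_eq_resGalOfEmb_of_mem_decomp v hx
      apply hFinj
      rw [transport_pointsMapOfEmb_smul hΦ, hFm]
      exact LocalPurity.map_galois_baseChange_point W v σ _
    refine ⟨⟨m, hmS⟩, Subtype.ext ?_⟩
    rw [hf]
    have h1 : d₀ ⟨m, hmS⟩ = Affine.Point.congrEquiv hX.symm R₀ := hinj (by rw [hd₀]; exact hFm)
    rw [h1]
    exact LocalPurity.congrEquiv_symm_apply_congrEquiv hX.symm R₀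
  -- `m ∈ M₀ ↔ f m ∈ X₀(K_v)`
  have hbridge : ∀ m : S, Affine.Point.congrEquiv hX (d₀ m) ∈
      (W.localMinimalIntegralModel v).nonsingularReductionSubgroup
        (integers_valuationRing_valuation (v.adicCompletionIntegers K) (v.adicCompletion K)) ↔
      (m : W.geomPoints) ∈ (nonsingularPart W hW₀ Φ).map (FixedPoints.addSubgroup
        ↥((adicCompletionPrime K v).inertia (absoluteGaloisGroup K)) W.geomPoints).subtype := by
    intro m
    have hmM₀' : (m : W.geomPoints) ∈ (nonsingularPart W hW₀ Φ).map (FixedPoints.addSubgroup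
        ↥((adicCompletionPrime K v).inertia (absoluteGaloisGroup K)) W.geomPoints).subtype ↔
        (⟨m, hmemFix m m.2⟩ : FixedPoints.addSubgroup
          ↥((adicCompletionPrime K v).inertia (absoluteGaloisGroup K)) W.geomPoints) ∈
          nonsingularPart W hW₀ Φ := by
      constructor
      · rintro ⟨y, hy, hym⟩
        have : y = ⟨m, hmemFix m m.2⟩ := Subtype.ext hym
        rwa [this] at hy
      · intro h
        exact ⟨⟨m, hmemFix m m.2⟩, h, rfl⟩
    rw [hmM₀', mem_nonsingularReductionSubgroup_iff, mem_nonsingularPart_iff]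
    change _ ↔ W₀.HasNonsingularReduction (Affine.Point.congrEquiv hW₀
      (Φ (pointsMapOfEmb W (closureEmb (K := K) (v.adicCompletion K)) m)))
    rw [← hd₀ m]
    obtain hR0 | ⟨x₀, y₀, hxy, hR⟩ : d₀ m = 0 ∨ ∃ x₀ y₀ h, d₀ m = .some x₀ y₀ h := by
      rcases d₀ m with _ | ⟨x, y, h⟩
      exacts [Or.inl rfl, Or.inr ⟨x, y, h, rfl⟩]
    · rw [hR0, map_zero, map_zero, map_zero]
      exact iff_of_true WeierstrassCurve.hasNonsingularReduction_zero
        WeierstrassCurve.hasNonsingularReduction_zero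
    · rw [hR, Affine.Point.congrEquiv_some, Affine.Point.map_some, Affine.Point.congrEquiv_some]
      exact (hasNonsingularReduction_algebraMap_iff hw (W.localMinimalIntegralModel v) h𝔐 hW₀
        _ _).symm
  -- the restricted bijection `S₀ → X₀(K_v)[p^∞]`
  let f₀ : S₀ → AddCommGroup.primaryComponent
      ↥((W.localMinimalIntegralModel v).nonsingularReductionSubgroup
        (integers_valuationRing_valuation (v.adicCompletionIntegers K) (v.adicCompletion K))) p :=
    fun m ↦ ⟨⟨Affine.Point.congrEquiv hX (d₀ ⟨m, m.2.1⟩), (hbridge ⟨m, m.2.1⟩).mpr m.2.2⟩,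
      (AddCommGroup.mem_primaryComponent).mpr (by
        obtain ⟨k, hk⟩ := hd₀tors ⟨m, m.2.1⟩
        exact ⟨k, Subtype.ext (by rw [AddSubgroupClass.coe_nsmul, ZeroMemClass.coe_zero]; exact hk)⟩)⟩
  have hf₀ : ∀ m : S₀, (((f₀ m : AddCommGroup.primaryComponent
      ↥((W.localMinimalIntegralModel v).nonsingularReductionSubgroup
        (integers_valuationRing_valuation (v.adicCompletionIntegers K) (v.adicCompletion K))) p) :
      (W.localMinimalIntegralModel v).nonsingularReductionSubgroup
        (integers_valuationRing_valuation (v.adicCompletionIntegers K) (v.adicCompletion K))) :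
      ((W.localMinimalIntegralModel v).baseChange (v.adicCompletion K)).toAffine.Point) =
      Affine.Point.congrEquiv hX (d₀ ⟨m, m.2.1⟩) := fun _ ↦ rfl
  have hf₀inj : Function.Injective f₀ := by
    intro a b hab
    have h : Affine.Point.congrEquiv hX (d₀ ⟨a, a.2.1⟩) = Affine.Point.congrEquiv hX (d₀ ⟨b, b.2.1⟩) := by
      rw [← hf₀, ← hf₀, hab]
    have h2 : f ⟨a, a.2.1⟩ = f ⟨b, b.2.1⟩ := Subtype.ext h
    exact Subtype.ext (congrArg (fun z : S ↦ (z : W.geomPoints)) (hfinj h2))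
  have hf₀surj : Function.Surjective f₀ := by
    rintro ⟨⟨R₀, hR₀E⟩, hR₀⟩
    obtain ⟨k, hk⟩ := (AddCommGroup.mem_primaryComponent).mp hR₀
    have hk' : p ^ k • R₀ = 0 := by
      have := congrArg (fun z : (W.localMinimalIntegralModel v).nonsingularReductionSubgroup
        (integers_valuationRing_valuation (v.adicCompletionIntegers K) (v.adicCompletion K)) ↦
          (z : ((W.localMinimalIntegralModel v).baseChange (v.adicCompletion K)).toAffine.Point)) hk
      simpa only [AddSubgroupClass.coe_nsmul, ZeroMemClass.coe_zero] using this
    obtain ⟨m, hm⟩ := hfsurj ⟨R₀, (AddCommGroup.mem_primaryComponent).mpr ⟨k, hk'⟩⟩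
    have hmG : Affine.Point.congrEquiv hX (d₀ m) = R₀ := by
      rw [← hf, hm]
    have hm₀ := (hbridge m).mp (by rw [hmG]; exact hR₀E)
    refine ⟨⟨m, m.2, hm₀⟩, Subtype.ext (Subtype.ext ?_)⟩
    rw [hf₀]
    exact hmG
  -- counting
  obtain ⟨hfinG, hcardG⟩ :=
    LocalPurity.natCard_primaryComponent_point_eq_mul_pow_localTamagawaNumber W v hpv
  haveI := hfinG
  rw [Nat.card_eq_of_bijective f ⟨hfinj, hfsurj⟩, Nat.card_eq_of_bijective f₀ ⟨hf₀inj, hf₀surj⟩]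
  exact hcardG

end Arithmetic

end Summit.BirchSwinnertonDyer.Rank1Residual.X11b.AcSelmer

end
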